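import Summits.CriticalPhenomena.PercolationContinuityZ3.Theorems.PercNearOneGluingNoHeavyLowerTailSahiC4CubeFour
import Summits.CriticalPhenomena.PercolationContinuityZ3.Theorems.PercNearOneGluingNoHeavyLowerTailSahiC4CubeLeThree
import HarnessLib

/-!
# `NoHeavyLowerTail` (stmt-CriticalPhenomena-4575) — `C₄` on at most FOUR coins, any index type, increasing or decreasing events; ALL ORDERS on four coins for fivewise-absorbing families

Support file, seat `prim-l12-p5` (gen 4), `--supports stmt-CriticalPhenomena-4575`, COMPUTATIONAL (through `…SahiC4CubeFour`).  No definitions,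
no named facts, no sorries.  The `C₄` analogue of `…SahiC3CubeAnyIndex` (same three-line transports), plus hierarchy lifting:

* `sahiC4_cube_le_four` — `{0,1}^m`, `m ≤ 4` (`m ≤ 3`: `SahiC4Cube.sahiC4_cube_le_three`; `m = 4`: `sahiC4_cube_four`);
* `sahiE4_relabel`, `sahiC4_of_card_le_four` — every finite index type with at most four elements;
* `sahiE4_reflect`, `sahiC4_lower_of_card_le_four` — DECREASING events (reflection `ω ↦ ωᶜ`, `p ↦ 1 − p`);
* `bernoulliWeight_sahiE_ind_nonneg_of_fivewise_fin_four` — with the function form `sahiPositive_bernoulliWeight_four_fin_four` and hierarchy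
  lifting (`SahiHereditaryMeetAbsorption.sahiE_nonneg_of_sahiPositive_of_absorbing`, `k = 4`): for every product measure on `2^{Fin 4}` and increasing
  events among any FIVE of which one contains the intersection of the other four, `E_m ≥ 0` for EVERY `m`.
Seat census (`code/g4/fivewise_rate_k4.py`): fivewise absorption holds for ≈ 100 % / 100 % / 99.9 % of random 5/6/7-sets of up-sets on `{0,1}^4`
(non-fivewise quintuples exist, frequency ~10⁻⁴); so Sahi's conjecture on the 4-cube is now a theorem at orders `3, 4` for everything and at all
orders outside a set of families of that frequency — the residue needs `C₅` on the non-fivewise quintuples.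
-/

namespace Summit.CriticalPhenomena.PercolationContinuityZ3.Theorems

namespace SahiHereditaryMeetAbsorption

open Finset MeasureTheory Literature.Combinatorics.Sahi2008 SahiC3Cube SahiC4Cube
open Literature.Probability.Percolation Literature.Probability.LatticeModels
open Literature.Probability.Percolation.DecisionTree (ind ind_of_mem ind_of_not_mem ind_nonneg)

/-- **`C₄` on `{0,1}^m`, `m ≤ 4`, every product measure.** [this file] -/
theorem sahiC4_cube_le_four {m : ℕ} (hm : m ≤ 4) (p : Fin m → unitInterval) {A B C D : Set (Set (Fin m))}
    (hA : IsUpperSet A) (hB : IsUpperSet B) (hC : IsUpperSet C) (hD : IsUpperSet D) :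
    0 ≤ sahiE4 (prodBernoulli p) A B C D := by
  rcases Nat.lt_or_ge m 4 with h | h
  · exact sahiC4_cube_le_three (by omega) p hA hB hC hD
  · obtain rfl : m = 4 := le_antisymm hm h
    exact sahiC4_cube_four p hA hB hC hD

variable {ι ι' : Type*}

/-- `E₄` is transported along a relabelling of the coordinates. [this file] -/
theorem sahiE4_relabel (e : ι ≃ ι') (p : ι → unitInterval) (q : ι' → unitInterval) (hpq : ∀ i, q (e i) = p i)
    (A B C D : Set (Set ι')) :
    sahiE4 (prodBernoulli q) A B C D = sahiE4 (prodBernoulli p) (SiteConfig.relabel e ⁻¹' A) (SiteConfig.relabel e ⁻¹' B)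
      (SiteConfig.relabel e ⁻¹' C) (SiteConfig.relabel e ⁻¹' D) := by
  simp only [sahiE4_def, ← Set.preimage_inter, prodBernoulli_real_preimage_relabel e p q hpq]

/-- **`C₄` for every product measure on at most four coordinates** (any finite index type; computational through the `m = 4` certificate). [this file] -/
theorem sahiC4_of_card_le_four [Fintype ι] (hι : Fintype.card ι ≤ 4) (q : ι → unitInterval) {A B C D : Set (Set ι)}
    (hA : IsUpperSet A) (hB : IsUpperSet B) (hC : IsUpperSet C) (hD : IsUpperSet D) : 0 ≤ sahiE4 (prodBernoulli q) A B C D := by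
  let e : Fin (Fintype.card ι) ≃ ι := (Fintype.equivFin ι).symm
  rw [sahiE4_relabel e (fun i => q (e i)) q (fun _ => rfl)]
  exact sahiC4_cube_le_four hι _ (isUpperSet_preimage_relabel e hA) (isUpperSet_preimage_relabel e hB)
    (isUpperSet_preimage_relabel e hC) (isUpperSet_preimage_relabel e hD)

/-- `E₄` of events under `P_q` is `E₄` of the complemented events under `P_{1−q}` (reflection `ω ↦ ωᶜ`). [this file] -/
theorem sahiE4_reflect (q : ι → unitInterval) (A B C D : Set (Set ι)) :
    sahiE4 (prodBernoulli q) A B C D =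
      sahiE4 (prodBernoulli fun i => unitInterval.symm (q i)) (compl ⁻¹' A) (compl ⁻¹' B) (compl ⁻¹' C) (compl ⁻¹' D) := by
  have hinv : ∀ S : Set (Set ι), compl ⁻¹' (compl ⁻¹' S) = S := fun S => by
    ext ω; simp
  simp only [sahiE4_def, ← Set.preimage_inter, ← real_preimage_compl_noMeas q (compl ⁻¹' _), hinv]

/-- **`C₄` for DECREASING events, every product measure on at most four coordinates.** [this file] -/
theorem sahiC4_lower_of_card_le_four [Fintype ι] (hι : Fintype.card ι ≤ 4) (q : ι → unitInterval) {A B C D : Set (Set ι)}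
    (hA : IsLowerSet A) (hB : IsLowerSet B) (hC : IsLowerSet C) (hD : IsLowerSet D) : 0 ≤ sahiE4 (prodBernoulli q) A B C D := by
  rw [sahiE4_reflect]
  exact sahiC4_of_card_le_four hι _ (isUpperSet_preimage_compl hA) (isUpperSet_preimage_compl hB)
    (isUpperSet_preimage_compl hC) (isUpperSet_preimage_compl hD)

/-- **All orders on four coins for fivewise-absorbing families**: product measure on `2^{Fin 4}`, increasing events among any five of which
one contains the intersection of the other four ⇒ `E_m(1_{A_0},…,1_{A_{m−1}}) ≥ 0` for every `m`. [this file] -/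
theorem bernoulliWeight_sahiE_ind_nonneg_of_fivewise_fin_four (p : Fin 4 → unitInterval) (m : ℕ)
    (A : Fin m → Set (Set (Fin 4))) (hA : ∀ i, IsUpperSet (A i))
    (h5 : ∀ S : Finset (Fin m), S.card = 5 → ∃ q ∈ S, ∀ ω, (∀ i ∈ S.erase q, ω ∈ A i) → ω ∈ A q) :
    0 ≤ sahiE (bernoulliWeight p) m (fun i => ind (A i)) := by
  refine sahiE_nonneg_of_sahiPositive_of_absorbing (isFKGMeasure_bernoulliWeight p).nonneg
    (isFKGMeasure_bernoulliWeight p).sum_eq_one (by norm_num : 1 ≤ 4) (sahiPositive_bernoulliWeight_four_fin_four p) m _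
    (fun i ω => ?_) (fun i => monotone_ind_of_isUpperSet (hA i))
    fun S hS => exists_absorber_of_cardwise (fun i => ind (A i)) (fun S' hS' => exists_absorber_ind A S' (h5 S' hS')) S hS
  by_cases h : ω ∈ A i
  · exact Or.inr (ind_of_mem h)
  · exact Or.inl (ind_of_not_mem h)

end SahiHereditaryMeetAbsorption

end Summit.CriticalPhenomena.PercolationContinuityZ3.Theorems
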